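import Summits.HodgeConjecture.HodgeConjecture.Theorems.WeilTypeLadderOnPath
import Literature.AlgebraicGeometry.HodgeTheory.WeilClassesFieldSplitSquareZetaEight
import HarnessLib

/-!
# Weil-type ladder — rung R3 (`WeilClassesCMField`, CM fields of degree `e > 2`) holds UNCONDITIONALLY on Deligne's loci `{T ⊗ ℚ(ζ₈)}`

B2b ladder `hodge-weil` (HOME `run/shared/lean/b2b/hodge-weil/`, CENSUS ## P3-g4, note `TWISTED-SQUARES.md` §10),
prover 3 generation 4 (strategy: special cases with CLASSICAL tools). Helper of the route item `WeilSixfolds`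
(R1, stmt-HodgeConjecture-2524) for the ladder's THIRD rung. No `sorry`, no definition, NO NAMED FACT: the
theorems below are unconditional, resting on the tree's PROVED theorem
`Literature.AlgebraicGeometry.HodgeTheory.weilClassesField_zetaEight_le_algebraicClasses`
(`HodgeTheory/WeilClassesFieldSplitSquareZetaEight`): for EVERY complex abelian variety `T` of dimension
`g ≥ 1`, on Deligne's `A = A₀ ⊗ ℚ(ζ₈) := (T × T) × (T × T)` with the `ℚ(ζ₈)`-action
`Ψ(X, Y) = (Φ₁Y, X)`, `Φ₁(x, y) = (-y, x)` (`Ψ⁴ = -𝟙`, minimal polynomial `X⁴ + 1`, `F = ℚ(Ψ) = ℚ(ζ₈)` a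
CM field with `[F : ℚ] = 4 > 2` and `4 · 2g = 2 dim A`), ALL the Weil classes
`weilClassesField A Ψ P (2g) = W_F ⊗ ℂ = ⊕_σ ⋀^{2g} V_{ℂ,σ}` are algebraic (Deligne, LNM 900 §4, Lemma 4.5 /
Remark 4.10 with `E = ℚ(ζ₈)`, made explicit on the carriers: each line `⋀^{2g} V_c`, `c⁴ = -1`, is spanned
by a class extracted from `(q₁ + q₂ + q₃ + q₄)^*[point of T]` by Lagrange projectors in the pull-backs
`u^*`, `u = (q₁, 4q₂, 2q₃, 8q₄)`).

## What is typed here (all unconditional)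

* R3 = `WeilClassesCMField` AT `(A, Ψ)` for every `T ∈ 𝒜_g`, `g ≥ 1`, in the rung's literal binder shape
  with `m = g` (`weilClassesCMField_body_zetaEight`; every hypothesis of the rung other than membership in
  `weilClassesField` is carried and unused — in particular no rationality or Hodge-type hypothesis is
  needed on this locus), and the hypothesis-free form `weilClassesField_zetaEight_subset_algebraicClasses`.
* ON-PATH: `HodgeConjecture ⟹` the same statement (`weilClassesCMField_body_zetaEight_of_hodgeConjecture`,
  a case of the summit via `WeilTypeLadderOnPath.weilClassesCMField_of_hodgeConjecture`).

Rung R3's docstring: "OPEN for every such `K` in every dimension"; typed so far on R3: CM points (André,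
conditional helpers) and Schoen's cyclic Prym `36`-folds for `ℚ(ζ₇)` (mod a refereed named fact). These
`g(g+1)/2`-dimensional loci (one for each `g ≥ 1`, inside the `ℚ(ζ₈)`-Weil families of dimension `4g` and
type `n_σ = g` for all four `σ`) are the first FACT-FREE points typed on R3. Honest scope: a positive-
dimensional proper sublocus of each R3 component it meets; 0 unconditional RUNGS above the floor.
-/

noncomputable section

open CategoryTheory
open Literature.AlgebraicGeometry Literature.AlgebraicGeometry.Motives
open Literature.AlgebraicGeometry.HodgeTheory
open Literature.AlgebraicTopology.SingularHomology

namespace Summit.HodgeConjecture.HodgeConjecture.WeilTypeLadder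

variable {T : AbelianVariety ℂ} {g : ℕ}

/-- **Every `ℚ(ζ₈)`-Weil class on Deligne's `A₀ ⊗ ℚ(ζ₈)` is algebraic** (set form, for every `P`).
[cite: Deligne1982HodgeCycles, §4 Lemma 4.5, Remark 4.10] -/
theorem weilClassesField_zetaEight_subset_algebraicClasses (hg : 0 < g) (hT : T.dim = g)
    (P : Polynomial ℤ) :
    let T₂ := T.prod T
    let Φ₁ : T₂ ⟶ T₂ := AbelianVariety.prodLift (AbelianVariety.snd T T ≫ (-(𝟙 T))) (AbelianVariety.fst T T)
    let Ψ : T₂.prod T₂ ⟶ T₂.prod T₂ :=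
      AbelianVariety.prodLift (AbelianVariety.snd T₂ T₂ ≫ Φ₁) (AbelianVariety.fst T₂ T₂)
    let A := T₂.prod T₂
    (weilClassesField A Ψ P (2 * g) : Set (complexBetti A.X (2 * g))) ⊆ algebraicClasses A.X g :=
  fun _ hc => weilClassesField_zetaEight_le_algebraicClasses hg hT P hc

/-- The dimension of Deligne's `A = (T × T) × (T × T)` is `4g`, so `4 · (2g) = 2 · dim A`.
[cite: Deligne1982HodgeCycles, §4] -/
theorem four_mul_two_mul_eq_two_mul_dim_zetaEight (hT : T.dim = g) :
    4 * (2 * g) = 2 * ((T.prod T).prod (T.prod T)).dim := by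
  rw [AbelianVariety.dim_prod, show (T.prod T).dim = 2 * g from dim_twistedSquare hT]
  ring

/-- **R3 (`WeilClassesCMField`) holds UNCONDITIONALLY at Deligne's `(A₀ ⊗ ℚ(ζ₈), Ψ)` for every
`T ∈ 𝒜_g`, `g ≥ 1`**, in the rung's literal binder shape with `m = g` (the only value allowed by
`e · 2m = 2 dim A = 8g` for `e = 4`): every class of `weilClassesField A Ψ P (2g)` is algebraic — all the
rung's other hypotheses (monic, degree, irreducible, `P(Ψ) = 0`, CM-ness, rationality, Hodge type) are
carried and not needed. [cite: Deligne1982HodgeCycles, §4 Lemma 4.5, Remark 4.10]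
[cite: MoonenZarhin1998WeilClasses, §1] -/
theorem weilClassesCMField_body_zetaEight (hg : 0 < g) (hT : T.dim = g) :
    let T₂ := T.prod T
    let Φ₁ : T₂ ⟶ T₂ := AbelianVariety.prodLift (AbelianVariety.snd T T ≫ (-(𝟙 T))) (AbelianVariety.fst T T)
    let Ψ : T₂.prod T₂ ⟶ T₂.prod T₂ :=
      AbelianVariety.prodLift (AbelianVariety.snd T₂ T₂ ≫ Φ₁) (AbelianVariety.fst T₂ T₂)
    let A := T₂.prod T₂
    ∀ (P : Polynomial ℤ) (e : ℕ),
      P.Monic → P.natDegree = e → 2 < e → Irreducible (P.map (Int.castRingHom ℚ)) →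
      Polynomial.eval₂ (Int.castRingHom (CategoryTheory.End A)) (Ψ : CategoryTheory.End A) P = 0 →
      e * (2 * g) = 2 * A.dim →
      (∀ ρ : ℂ, Polynomial.eval₂ (Int.castRingHom ℂ) ρ P = 0 → starRingEnd ℂ ρ ≠ ρ) →
      (∃ Q : Polynomial ℚ, ∀ ρ : ℂ, Polynomial.eval₂ (Int.castRingHom ℂ) ρ P = 0 →
          Polynomial.eval₂ (algebraMap ℚ ℂ) ρ Q = starRingEnd ℂ ρ) →
        ∀ c ∈ weilClassesField A Ψ P (2 * g), IsRationalClass c →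
          IsOfHodgeType A.dim A.X (2 * g) g g c → c ∈ algebraicClasses A.X g :=
  fun P _ _ _ _ _ _ _ _ _ _ hc _ _ => weilClassesField_zetaEight_le_algebraicClasses hg hT P hc

/-- ON-PATH: `HodgeConjecture ⟹` the R3-body statement at Deligne's `(A₀ ⊗ ℚ(ζ₈), Ψ)` (a case of the
summit, through `weilClassesCMField_of_hodgeConjecture`). -/
theorem weilClassesCMField_body_zetaEight_of_hodgeConjecture (h : _root_.HodgeConjecture) :
    let T₂ := T.prod T
    let Φ₁ : T₂ ⟶ T₂ := AbelianVariety.prodLift (AbelianVariety.snd T T ≫ (-(𝟙 T))) (AbelianVariety.fst T T)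
    let Ψ : T₂.prod T₂ ⟶ T₂.prod T₂ :=
      AbelianVariety.prodLift (AbelianVariety.snd T₂ T₂ ≫ Φ₁) (AbelianVariety.fst T₂ T₂)
    let A := T₂.prod T₂
    ∀ (P : Polynomial ℤ) (e : ℕ),
      P.Monic → P.natDegree = e → 2 < e → Irreducible (P.map (Int.castRingHom ℚ)) →
      Polynomial.eval₂ (Int.castRingHom (CategoryTheory.End A)) (Ψ : CategoryTheory.End A) P = 0 →
      e * (2 * g) = 2 * A.dim →
      (∀ ρ : ℂ, Polynomial.eval₂ (Int.castRingHom ℂ) ρ P = 0 → starRingEnd ℂ ρ ≠ ρ) →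
      (∃ Q : Polynomial ℚ, ∀ ρ : ℂ, Polynomial.eval₂ (Int.castRingHom ℂ) ρ P = 0 →
          Polynomial.eval₂ (algebraMap ℚ ℂ) ρ Q = starRingEnd ℂ ρ) →
        ∀ c ∈ weilClassesField A Ψ P (2 * g), IsRationalClass c →
          IsOfHodgeType A.dim A.X (2 * g) g g c → c ∈ algebraicClasses A.X g := by
  intro T₂ Φ₁ Ψ A P e hmon hdeg he hirr hev hdim hnr hQ c hc hrat hhodge
  exact weilClassesCMField_of_hodgeConjecture h A Ψ P e g hmon hdeg he hirr hev hdim hnr hQ c hc hrat hhodge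

end Summit.HodgeConjecture.HodgeConjecture.WeilTypeLadder

end
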